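/-
Origin: expansion seat `planner-pub-hodgecm-prl2-g5-0`, handover #3 2026-08-18T07:59:05Z (`HOME/pub-hodgecm-prl2-g5/lean/Prl2g5/TwistSupport.lean`, md5 17118120, 110 lines);
landed by the gen-7 packager in gate run 26 as `HodgeCM/Automorphic/TwistSupport.lean` (verbatim).
-/
/-
Copyright: pub-hodgecm expansion lineage prl2 (REDUCE `RealisationExistsPerL` / `Face`), generation 5.
Authors: planner-pub-hodgecm-prl2-g5-0.

# Eigenvectors of a unitary representation for distinct characters are orthogonal — the kernel of the nonvanishing
# step of DEEP SUPPORT (`IsoDatum.CompTower.deepen`, `HodgeCM.StubTree.ComponentTower`; REDUCTION-v5 §M1(c))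

ADDITIVE, three small lemmas over prl1-g3's `HodgeCM.Automorphic.IsotypicDecomposition` (only `IsUnitaryRep` and
`RepDecomp.norm_map` are used).  In the derivation of the (P∘U) clause `deepen` (GAPS prl2g5-M1/K1) the one step that
is not a reading of a published statement is: "the component `P_j(e₁″·vec d) = (|Ĉ′|/|Ĉ″|) Σ_{[χ] ∈ Ĉ″/Ĉ′} w_χ`,
`w_χ = U_χ P_{j·χ⁻¹}(vec d)`, is nonzero, because the `w_χ` are eigenvectors of the unitary group `R(K′)` for the
pairwise distinct characters `k ↦ χ(det k)` and `w_1 = P_j(vec d) ≠ 0`".  This file makes that step KERNEL in the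
abstract: for ANY unitary representation `R` of a group `K` on a complex inner-product space,
* `norm_eigenvalue_eq_one` — an eigen-character has modulus one on a nonzero eigenvector;
* `inner_eq_zero_of_eigen_ne` — eigenvectors for characters that differ at one group element are orthogonal;
* `sum_ne_zero_of_eigen_pairwise_ne` — a finite sum of such eigenvectors with pairwise distinct characters is nonzero
  as soon as one summand is.
Instantiation (model side, (U)): `K = K′` acting through `R`, index = the cosets `Ĉ″/Ĉ′`, `w_[χ]` as above with
character `k ↦ χ(det k)` (`R(k)U_χ = χ(det k)·U_χR(k)`, `R(k)` fixes `vec d` and commutes with `P_m`), distinct cosets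
giving distinct characters of `K′` (a character of `T(L⁺)\T(𝔸_f)` trivial on `det K′` lies in `Ĉ′`), `i₀` = the
trivial coset.
-/
import Summits.HodgeConjecture.HodgeCM.Automorphic.IsotypicDecomposition_2

/-! PORT of `HodgeCM/Automorphic/TwistSupport.lean` (HodgeCMPerL run 82) — verbatim mechanical port; provenance in the PORT header line. -/

noncomputable section

open scoped BigOperators InnerProductSpace ComplexConjugate

namespace HodgeCM

namespace RepDecomp

open HodgeCM.PerL34.Spectral (IsUnitaryRep)

variable {H : Type*} [NormedAddCommGroup H] [InnerProductSpace ℂ H]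
variable {K : Type*} [Group K] {R : K →* (H →L[ℂ] H)}

/-- An eigen-character of a unitary representation has modulus one on a nonzero eigenvector. -/
theorem norm_eigenvalue_eq_one (hR : IsUnitaryRep R) {v : H} {k : K} {c : ℂ} (hv : R k v = c • v)
    (hv0 : v ≠ 0) : ‖c‖ = 1 := by
  have h := RepDecomp.norm_map hR k v
  rw [hv, norm_smul] at h
  exact mul_right_cancel₀ (norm_ne_zero_iff.mpr hv0) (h.trans (one_mul _).symm)

/-- **Eigenvectors of a unitary representation for distinct characters are orthogonal**: if `R k v = χ k • v` and
`R k w = ψ k • w` for all `k`, and `χ k ≠ ψ k` for some `k`, then `⟪v, w⟫ = 0`. -/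
theorem inner_eq_zero_of_eigen_ne (hR : IsUnitaryRep R) {v w : H} {χ ψ : K → ℂ}
    (hv : ∀ k, R k v = χ k • v) (hw : ∀ k, R k w = ψ k • w) {k : K} (hk : χ k ≠ ψ k) : ⟪v, w⟫_ℂ = 0 := by
  by_cases hv0 : v = 0
  · simp [hv0]
  by_cases hw0 : w = 0
  · simp [hw0]
  have h1 : ‖χ k‖ = 1 := norm_eigenvalue_eq_one hR (hv k) hv0
  have hχ0 : χ k ≠ 0 := by
    intro h0; rw [h0, norm_zero] at h1; exact zero_ne_one h1
  have hconj : conj (χ k) = (χ k)⁻¹ := by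
    have hmul : conj (χ k) * χ k = 1 := by
      rw [Complex.conj_mul', h1]; simp
    exact eq_inv_of_mul_eq_one_left hmul
  have h := hR k v w
  rw [hv k, hw k, inner_smul_left, inner_smul_right, hconj] at h
  -- h : (χ k)⁻¹ * (ψ k * ⟪v, w⟫) = ⟪v, w⟫
  have h3 : (ψ k - χ k) * ⟪v, w⟫_ℂ = 0 := by
    have h' := congrArg (fun z => χ k * z) h
    simp only [← mul_assoc, mul_inv_cancel₀ hχ0, one_mul] at h'
    linear_combination h'
  rcases mul_eq_zero.mp h3 with h4 | h4
  · exact absurd (sub_eq_zero.mp h4).symm hk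
  · exact h4

/-- **A finite sum of eigenvectors with pairwise distinct eigen-characters is nonzero as soon as one summand is.**
(The nonvanishing step of DEEP SUPPORT, REDUCTION-v5 §M1(c).) -/
theorem sum_ne_zero_of_eigen_pairwise_ne (hR : IsUnitaryRep R) {ι : Type*} (s : Finset ι) (w : ι → H)
    (χ : ι → K → ℂ) (hw : ∀ i ∈ s, ∀ k, R k (w i) = χ i k • w i)
    (hχ : ∀ i ∈ s, ∀ j ∈ s, i ≠ j → ∃ k, χ i k ≠ χ j k) {i₀ : ι} (hi₀ : i₀ ∈ s) (h0 : w i₀ ≠ 0) :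
    ∑ i ∈ s, w i ≠ 0 := by
  intro hsum
  have hdiag : ⟪w i₀, ∑ i ∈ s, w i⟫_ℂ = ⟪w i₀, w i₀⟫_ℂ := by
    rw [inner_sum]
    refine Finset.sum_eq_single i₀ (fun j hj hne => ?_) (fun h => absurd hi₀ h)
    obtain ⟨k, hk⟩ := hχ i₀ hi₀ j hj (Ne.symm hne)
    exact inner_eq_zero_of_eigen_ne hR (hw i₀ hi₀) (hw j hj) hk
  rw [hsum, inner_zero_right] at hdiag
  exact h0 (inner_self_eq_zero.mp hdiag.symm)

/-- The same with a norm bound: `‖w i₀‖ ≤ ‖∑ i ∈ s, w i‖` (Bessel for one term of an orthogonal sum). -/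
theorem norm_le_norm_sum_of_eigen_pairwise_ne (hR : IsUnitaryRep R) {ι : Type*} (s : Finset ι) (w : ι → H)
    (χ : ι → K → ℂ) (hw : ∀ i ∈ s, ∀ k, R k (w i) = χ i k • w i)
    (hχ : ∀ i ∈ s, ∀ j ∈ s, i ≠ j → ∃ k, χ i k ≠ χ j k) {i₀ : ι} (hi₀ : i₀ ∈ s) :
    ‖w i₀‖ ≤ ‖∑ i ∈ s, w i‖ := by
  have hdiag : ⟪w i₀, ∑ i ∈ s, w i⟫_ℂ = ⟪w i₀, w i₀⟫_ℂ := by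
    rw [inner_sum]
    refine Finset.sum_eq_single i₀ (fun j hj hne => ?_) (fun h => absurd hi₀ h)
    obtain ⟨k, hk⟩ := hχ i₀ hi₀ j hj (Ne.symm hne)
    exact inner_eq_zero_of_eigen_ne hR (hw i₀ hi₀) (hw j hj) hk
  by_cases h0 : w i₀ = 0
  · simp [h0]
  have hpos : 0 < ‖w i₀‖ := norm_pos_iff.mpr h0
  have hre : RCLike.re ⟪w i₀, ∑ i ∈ s, w i⟫_ℂ = ‖w i₀‖ * ‖w i₀‖ := by
    rw [hdiag, inner_self_eq_norm_mul_norm]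
  have hle : ‖w i₀‖ * ‖w i₀‖ ≤ ‖w i₀‖ * ‖∑ i ∈ s, w i‖ := by
    rw [← hre]
    exact (RCLike.re_le_norm _).trans (norm_inner_le_norm _ _)
  exact le_of_mul_le_mul_left hle hpos

end RepDecomp

end HodgeCM

end
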